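import Mathlib.LinearAlgebra.Matrix.Charpoly.Coeff
import Mathlib.LinearAlgebra.Matrix.Trace
import Mathlib.Data.Matrix.Block
import HarnessLib

/-!
# Trace sequences and Lefschetz sequences are linear recurrence sequences: `Σ_j χ_M[j] · tr(M^{n+j} B) = 0`
# (Cayley–Hamilton), annihilating polynomials of multiples and linear combinations, and the normal form
# `Σₖ ± tr(Mₖⁿ) = tr(Aⁿ) - tr(Bⁿ)` (Byszewski–Graff–Ward 2021 §5: Def. 5.1, Prop. 5.2, Lemma 5.3, Thm. 5.4)

Printed statements followed.  J. Byszewski, G. Graff, T. Ward, *Dold sequences, periodic points, and dynamics*,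
Bull. London Math. Soc. 53 (2021) 1263–1298 (held `paper:arxiv-2007.04031`, text chunks p0016–p0017):
**Definition 5.1** «A sequence of integers `(a_n)` is a Lefschetz sequence if there exist square integer
matrices `A` and `B` such that `a_n = trace Aⁿ - trace Bⁿ` for all `n ∈ ℕ`»; **Proposition 5.2** «A sequence of
integers `(a_n)` is a Lefschetz sequence if and only if there exist algebraic numbers `λ_1, …, λ_s` and
integers `m_1, …, m_s` such that `a_n = Σ_{i=1}^s m_i λ_iⁿ` for all `n ∈ ℕ`»; «We recall that a sequence `(c_n)`
(taking values in a field) is a linear recurrence sequence if there exists an integer `p` (the order of the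
recurrence) and constants `α_0, …, α_{p-1}` with `α_0 ≠ 0` such that `c_{n+p} = α_{p-1} c_{n+p-1} + … + α_0 c_n`
for all `n ≥ 1`»; **Lemma 5.3** «A power series `f(z) = Σ_{n=0}^∞ c_n zⁿ` with coefficients in a field `𝕂`
represents a rational function `P(z)/Q(z)` (where `P` and `Q` are polynomials) if and only if its coefficients
satisfy a linear recurrence relation. Furthermore, the order of the recurrence is at most `max(deg P, deg Q)`»;
**Theorem 5.4** «A sequence of integers `(a_n)` is a Lefschetz sequence if and only if `(a_n)` is a Dold
sequence with the property that its generating sequence `(c_n)` is a linear recurrence sequence»; Theorem 5.7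
(chunk p0017) computes with «`a_n = trace Aⁿ - trace Bⁿ` for all `n ∈ ℕ`, where `A ∈ M_{k,k}(ℂ)` and
`B ∈ M_{ℓ,ℓ}(ℂ)`» and the eigenvalues of `A`, `B`.

What is formalized (theorems only; no definition, no named fact).  A polynomial `p = Σ_j p_j t^j`
ANNIHILATES a sequence `a` when `Σ_{j=0}^{deg p} p_j a_{n+j} = 0` for every `n` (for monic `p` of degree `d`
this is the linear recurrence `a_{n+d} = -Σ_{j<d} p_j a_{n+j}` of order `d` with characteristic polynomial
`p` — Mathlib's `LinearRecurrence.IsSolution` with `coeffs j = -p_j`).  Over any commutative ring: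

* §1 **`sum_charpoly_coeff_mul_trace_pow_add_mul`**: `Σ_{j=0}^{d} χ_M[j] tr(M^{n+j} B) = 0` for all square
  matrices `M`, `B` of size `d` (CAYLEY–HAMILTON: the sum is `tr(Mⁿ χ_M(M) B)`); `B = 1`:
  **`sum_charpoly_coeff_mul_trace_pow_add`** — the trace sequence `(tr Mⁿ)` satisfies the linear recurrence with
  characteristic polynomial `χ_M` (the sequence of Prop. 5.2, `tr Mⁿ = Σ λ_iⁿ` over the eigenvalues; the
  printed route to a recurrence is the rational generating function of Lemma 5.3 — here Cayley–Hamilton);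
* §2 annihilators: `sum_range_coeff_mul_eq_of_natDegree_lt` (the truncation of the sum is immaterial),
  **`sum_coeff_mul_mul_eq_zero`** (`p` annihilates `a` ⟹ every multiple `q p` does), `sum_coeff_prod_mul_eq_zero`
  (products over a finite family), `sum_coeff_mul_sum_mul_eq_zero` (linear combinations) — so every Lefschetz
  sequence `tr Aⁿ - tr Bⁿ`, indeed every `Σₖ wₖ tr(Mₖⁿ)`, satisfies the recurrence with characteristic
  polynomial `∏ₖ χ_{Mₖ}` (**`sum_coeff_prod_charpoly_mul_sum_mul_trace_pow_add_eq_zero`**);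
* §3 Definition 5.1's normal form: `trace_blockDiagonal'_pow` (`tr((⊕ₖ Mₖ)ⁿ) = Σₖ tr(Mₖⁿ)` for blocks of any
  sizes, Mathlib's `Matrix.blockDiagonal'`) and **`sum_ite_mul_trace_pow_eq_trace_pow_sub`** (a signed sum
  `Σₖ ±tr(Mₖⁿ)` IS a Lefschetz sequence `tr(Aⁿ) - tr(Bⁿ)` with `A = ⊕_{+} Mₖ`, `B = ⊕_{-} Mₖ`).

(Used by `AlgebraicGeometry/HodgeTheory/AbelianVarietyLefschetzNumbersLinearRecurrence.lean`: the Lefschetz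
numbers of the iterates of a self-map of `A(ℂ)` are a Lefschetz sequence and satisfy an integral recurrence
of order `4^g`.)

## References

* [ByszewskiGraffWard2021] J. Byszewski, G. Graff, T. Ward, *Dold sequences, periodic points, and dynamics*,
  Bull. London Math. Soc. 53 (2021) 1263–1298 — §5: Def. 5.1, Prop. 5.2, Lemma 5.3, Thm. 5.4, Thm. 5.7 (held
  text chunks p0016, p0017).
-/

namespace Literature.Dynamics.FixedPoints

open Function Finset Polynomial

/-! ## §1 The Cayley–Hamilton recurrence of a (weighted) trace sequence -/

section CayleyHamilton

variable {ι : Type*} [Fintype ι] [DecidableEq ι] {R : Type*} [CommRing R]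

/-- `Σ_{j < N} p_j tr(M^{n+j} B) = tr(Mⁿ · p(M) · B)` for any polynomial `p` of degree `< N` (linearity of the
trace). [cite: ByszewskiGraffWard2021, §5 Def. 5.1 and Prop. 5.2 (text chunk p0016)] -/
theorem sum_coeff_mul_trace_pow_add_mul_eq (M B : Matrix ι ι R) (p : R[X]) {N : ℕ} (hN : p.natDegree < N)
    (n : ℕ) :
    ∑ j ∈ range N, p.coeff j * (M ^ (n + j) * B).trace = (M ^ n * aeval M p * B).trace := by
  rw [aeval_eq_sum_range' hN, mul_sum, sum_mul, Matrix.trace_sum]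
  refine sum_congr rfl fun j _ ↦ ?_
  rw [mul_smul_comm, ← pow_add, smul_mul_assoc, Matrix.trace_smul, smul_eq_mul]

/-- **`Σ_{j=0}^{d} χ_M[j] · tr(M^{n+j} B) = 0`** for all square matrices `M`, `B` of size `d` over a commutative
ring and all `n` (CAYLEY–HAMILTON: the sum is `tr(Mⁿ χ_M(M) B) = 0`): every weighted trace sequence
`(tr(Mⁿ B))_n` satisfies the linear recurrence of order `d` with characteristic polynomial `χ_M` (cf. Lemma 5.3:
the printed route is the rationality of the generating function). [cite: ByszewskiGraffWard2021, §5 Prop. 5.2 and Lemma 5.3 (text chunk p0016)] -/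
theorem sum_charpoly_coeff_mul_trace_pow_add_mul (M B : Matrix ι ι R) (n : ℕ) :
    ∑ j ∈ range (Fintype.card ι + 1), M.charpoly.coeff j * (M ^ (n + j) * B).trace = 0 := by
  nontriviality R
  rw [sum_coeff_mul_trace_pow_add_mul_eq M B M.charpoly (by rw [Matrix.charpoly_natDegree_eq_dim]; omega),
    Matrix.aeval_self_charpoly, mul_zero, zero_mul, Matrix.trace_zero]

/-- **The trace sequence `(tr Mⁿ)` satisfies the linear recurrence of order `d` with characteristic polynomial
`χ_M`: `Σ_{j=0}^{d} χ_M[j] · tr(M^{n+j}) = 0` for every `n`** (`χ_M` monic of degree `d`, so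
`tr(M^{n+d}) = -Σ_{j<d} χ_M[j] tr(M^{n+j})`; Prop. 5.2's sequences `Σ m_i λ_iⁿ` are of this kind).
[cite: ByszewskiGraffWard2021, §5 Prop. 5.2 and Lemma 5.3 (text chunk p0016)] -/
theorem sum_charpoly_coeff_mul_trace_pow_add (M : Matrix ι ι R) (n : ℕ) :
    ∑ j ∈ range (Fintype.card ι + 1), M.charpoly.coeff j * (M ^ (n + j)).trace = 0 := by
  simpa only [mul_one] using sum_charpoly_coeff_mul_trace_pow_add_mul M 1 n

end CayleyHamilton

/-! ## §2 Annihilating polynomials: truncation, multiples, linear combinations -/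

section Annihilator

variable {R : Type*} [CommRing R]

/-- The truncated sum `Σ_{j < N} p_j a_{n+j}` does not depend on `N > deg p` (the coefficients vanish beyond the
degree). [cite: ByszewskiGraffWard2021, §5, «linear recurrence sequence» (text chunk p0016)] -/
theorem sum_range_coeff_mul_eq_of_natDegree_lt (p : R[X]) (a : ℕ → R) (n : ℕ) {N N' : ℕ}
    (hN : p.natDegree < N) (hN' : p.natDegree < N') :
    ∑ j ∈ range N, p.coeff j * a (n + j) = ∑ j ∈ range N', p.coeff j * a (n + j) := by
  wlog h : N ≤ N' generalizing N N'
  · exact (this hN' hN (le_of_not_ge h)).symm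
  rw [← sum_range_add_sum_Ico _ h, left_eq_add]
  refine sum_eq_zero fun j hj ↦ ?_
  rw [coeff_eq_zero_of_natDegree_lt (by have := (mem_Ico.1 hj).1; omega), zero_mul]

/-- **If `p` annihilates the sequence `a` (`Σ_j p_j a_{n+j} = 0` for all `n`), so does every multiple `q p`**
(induction on the monomials of `q`: `(c t^k p) · a` is `c` times the `p`-sum shifted by `k`). A linear
recurrence sequence for `p` is one for every multiple of `p`. [cite: ByszewskiGraffWard2021, §5 Lemma 5.3 and Thm. 5.4 (text chunk p0016)] -/
theorem sum_coeff_mul_mul_eq_zero (p q : R[X]) (a : ℕ → R)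
    (h : ∀ n, ∑ j ∈ range (p.natDegree + 1), p.coeff j * a (n + j) = 0) (n : ℕ) :
    ∑ j ∈ range ((q * p).natDegree + 1), (q * p).coeff j * a (n + j) = 0 := by
  induction q using Polynomial.induction_on' with
  | add q₁ q₂ h₁ h₂ =>
    have hlt : (q₁ * p + q₂ * p).natDegree < (q₁ * p).natDegree + 1 + ((q₂ * p).natDegree + 1) :=
      lt_of_le_of_lt (natDegree_add_le _ _) (by omega)
    rw [add_mul, sum_range_coeff_mul_eq_of_natDegree_lt _ a n (Nat.lt_succ_self _) hlt]
    simp only [coeff_add, add_mul, sum_add_distrib]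
    rw [← sum_range_coeff_mul_eq_of_natDegree_lt (q₁ * p) a n (Nat.lt_succ_self _) (by omega),
      ← sum_range_coeff_mul_eq_of_natDegree_lt (q₂ * p) a n (Nat.lt_succ_self _) (by omega), h₁, h₂,
      add_zero]
  | monomial k c =>
    have hlt : (monomial k c * p).natDegree < k + (p.natDegree + 1) := by
      refine lt_of_le_of_lt natDegree_mul_le ?_
      have := natDegree_monomial_le (R := R) (m := k) c
      omega
    rw [sum_range_coeff_mul_eq_of_natDegree_lt _ a n (Nat.lt_succ_self _) hlt, sum_range_add]
    -- below degree `k` the coefficients of `c X^k p` vanish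
    rw [sum_eq_zero fun j hj ↦ ?_, zero_add]
    · -- the remaining coefficients are `c p_l`
      have : ∀ l ∈ range (p.natDegree + 1), (monomial k c * p).coeff (k + l) * a (n + (k + l)) =
          c * (p.coeff l * a (n + k + l)) := fun l _ ↦ by
        rw [add_comm k l, coeff_monomial_mul, mul_assoc, add_assoc, add_comm l k]
      rw [sum_congr rfl this, ← mul_sum, h (n + k), mul_zero]
    · have hj' : j < k := mem_range.1 hj
      rw [← C_mul_X_pow_eq_monomial, mul_assoc, coeff_C_mul, coeff_X_pow_mul', if_neg (by omega), mul_zero,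
        zero_mul]

/-- **Products**: if `P k` annihilates `a` for some `k ∈ s`, then `∏_{i ∈ s} P i` annihilates `a`.
[cite: ByszewskiGraffWard2021, §5 Lemma 5.3 and Thm. 5.4 (text chunk p0016)] -/
theorem sum_coeff_prod_mul_eq_zero {κ : Type*} [DecidableEq κ] (s : Finset κ) (P : κ → R[X]) (a : ℕ → R)
    {k : κ} (hk : k ∈ s) (h : ∀ n, ∑ j ∈ range ((P k).natDegree + 1), (P k).coeff j * a (n + j) = 0) (n : ℕ) :
    ∑ j ∈ range ((∏ i ∈ s, P i).natDegree + 1), (∏ i ∈ s, P i).coeff j * a (n + j) = 0 := by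
  rw [← Finset.mul_prod_erase s P hk, mul_comm]
  exact sum_coeff_mul_mul_eq_zero (P k) _ a h n

/-- **Linear combinations**: if `P` annihilates each sequence `a k`, `k ∈ s`, then `P` annihilates
`Σ_{k ∈ s} w_k · a k` for any weights `w_k` (the solutions of a linear recurrence form a module).
[cite: ByszewskiGraffWard2021, §5 Prop. 5.2 (text chunk p0016)] -/
theorem sum_coeff_mul_sum_mul_eq_zero {κ : Type*} (s : Finset κ) (P : R[X]) (w : κ → R) (a : κ → ℕ → R)
    (h : ∀ k ∈ s, ∀ n, ∑ j ∈ range (P.natDegree + 1), P.coeff j * a k (n + j) = 0) (n : ℕ) :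
    ∑ j ∈ range (P.natDegree + 1), P.coeff j * ∑ k ∈ s, w k * a k (n + j) = 0 := by
  simp_rw [mul_sum]
  rw [sum_comm]
  refine sum_eq_zero fun k hk ↦ ?_
  have : ∑ j ∈ range (P.natDegree + 1), P.coeff j * (w k * a k (n + j)) =
      w k * ∑ j ∈ range (P.natDegree + 1), P.coeff j * a k (n + j) := by
    rw [mul_sum]
    exact sum_congr rfl fun j _ ↦ by ring
  rw [this, h k hk n, mul_zero]

/-- **Every weighted sum of trace sequences `a_n = Σ_{k ∈ s} w_k tr(M_kⁿ)` — in particular every Lefschetz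
sequence `tr Aⁿ - tr Bⁿ` — satisfies the linear recurrence with characteristic polynomial `∏_{k ∈ s} χ_{M_k}`**
(monic of degree the total size): `Σ_{j=0}^{deg} (∏ₖ χ_{Mₖ})[j] · a_{n+j} = 0` for all `n`.  The square matrices
`M_k` may have different sizes `m k`. [cite: ByszewskiGraffWard2021, §5 Def. 5.1, Prop. 5.2, Thm. 5.4 (text chunk p0016)] -/
theorem sum_coeff_prod_charpoly_mul_sum_mul_trace_pow_add_eq_zero {κ : Type*} [DecidableEq κ]
    {m : κ → Type*} [∀ k, Fintype (m k)] [∀ k, DecidableEq (m k)] (s : Finset κ)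
    (M : ∀ k, Matrix (m k) (m k) R) (w : κ → R) (n : ℕ) :
    ∑ j ∈ range ((∏ k ∈ s, (M k).charpoly).natDegree + 1), (∏ k ∈ s, (M k).charpoly).coeff j *
      ∑ k ∈ s, w k * ((M k) ^ (n + j)).trace = 0 := by
  refine sum_coeff_mul_sum_mul_eq_zero s _ w (fun k i ↦ ((M k) ^ i).trace) (fun k hk n' ↦ ?_) n
  refine sum_coeff_prod_mul_eq_zero s (fun i ↦ (M i).charpoly) (fun i ↦ ((M k) ^ i).trace) hk
    (fun n'' ↦ ?_) n'
  nontriviality R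
  rw [Matrix.charpoly_natDegree_eq_dim]
  exact sum_charpoly_coeff_mul_trace_pow_add (M k) n''

end Annihilator

/-! ## §3 Block sums: `tr((⊕ₖ Mₖ)ⁿ) = Σₖ tr(Mₖⁿ)`; signed sums of trace sequences are Lefschetz sequences -/

section Blocks

variable {R : Type*} [CommRing R] {κ : Type*} [Fintype κ] [DecidableEq κ] {m : κ → Type*}
  [∀ k, Fintype (m k)] [∀ k, DecidableEq (m k)]

/-- `tr((⊕ₖ Mₖ)ⁿ) = Σₖ tr(Mₖⁿ)` for a finite family of square matrices of any sizes (the block-diagonal sum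
`⊕ₖ Mₖ = Matrix.blockDiagonal' M` is multiplicative and its trace is the sum of the traces).
[cite: ByszewskiGraffWard2021, §5 Def. 5.1 (text chunk p0016)] -/
theorem trace_blockDiagonal'_pow (M : ∀ k, Matrix (m k) (m k) R) (n : ℕ) :
    ((Matrix.blockDiagonal' M) ^ n).trace = ∑ k, ((M k) ^ n).trace := by
  rw [← Matrix.blockDiagonal'_pow, Matrix.trace_blockDiagonal']
  rfl

/-- **A signed sum of trace sequences is a Lefschetz sequence** (Definition 5.1 «there exist square integer
matrices `A` and `B` such that `a_n = trace Aⁿ - trace Bⁿ` for all `n`»): with the signs given by a predicate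
`p` on the indices, `Σₖ (±1)·tr(Mₖⁿ) = tr(Aⁿ) - tr(Bⁿ)` for `A = ⊕_{p k} Mₖ` and `B = ⊕_{¬p k} Mₖ` (block
diagonal sums), for every `n`. [cite: ByszewskiGraffWard2021, §5 Def. 5.1 (text chunk p0016)] -/
theorem sum_ite_mul_trace_pow_eq_trace_pow_sub (M : ∀ k, Matrix (m k) (m k) R) (p : κ → Prop)
    [DecidablePred p] (n : ℕ) :
    ∑ k, (if p k then (1 : R) else -1) * ((M k) ^ n).trace =
      ((Matrix.blockDiagonal' fun k : {k // p k} ↦ M k) ^ n).trace -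
        ((Matrix.blockDiagonal' fun k : {k // ¬p k} ↦ M k) ^ n).trace := by
  rw [trace_blockDiagonal'_pow, trace_blockDiagonal'_pow, ← Fintype.sum_subtype_add_sum_subtype p,
    sub_eq_add_neg, ← sum_neg_distrib]
  congr 1
  · exact Finset.sum_congr rfl fun k _ ↦ by rw [if_pos k.2, one_mul]
  · exact Finset.sum_congr rfl fun k _ ↦ by rw [if_neg k.2, neg_one_mul]

end Blocks


end Literature.Dynamics.FixedPoints
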